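import Summits.Ventures.HSemireg.UntwistCocycleTwistDualHom
import HarnessLib

/-!
# Venture HSemireg — route R1.0, untwisted reading: naturality of the comparison
# `λ_G : (𝓗om(E^∨, G)) ⊗ M ⟶ 𝓗om((E ⊗ M)^∨, G)` in the coefficients `G` (gs-g4; sequel of
# `UntwistCocycleTwistDualHom.lean`)

HONEST FRAMING. Module-level sheaf algebra on the tree's REAL carriers (th-4's cocycle twist `- ⊗ M`, the internal
Hom, the comparison `λ_G = CocycleTwist.dualHomTwist`). Nothing about any variety; no gerbe; nothing here says HC,
HC_CM or HC_AV is proved.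

* `dualHomTwist_app_trivSection_comp` — **`λ_{G'}((φ ≫ t) ⊗ t_x) = λ_G(φ ⊗ t_x) ≫ t`** for a LOCAL morphism
  `t : G|_U → G'|_U` (over opens inside `U_x`): the input that makes the level-`j` jet comparison
  `(φ, ψ) ↦ (λ_j(φ ⊗ t_x), λ_{j+1}(ψ ⊗ t_x))` linear for the twisted structures `a · (φ, ψ) = (a φ, a ψ + da ∧ φ)` of the
  HIGHER Atiyah sequences `0 → E ⊗ Ωʲ⁺¹ → Pʲ(E) → E ⊗ Ωʲ → 0` (`da ∧ φ = φ ≫ (∧)| ≫ ev_{da}` is such a post-composition)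
  — row `q ≥ 2` material (see `general-structure/LEIBNIZ-ROW2-PLAN-gs-g4.md`);
* `twistMap_sheafHomMap_comp_dualHomTwist` — **naturality in `G` for global morphisms**:
  `(𝓗om(E^∨, g)) ⊗ M ≫ λ_{G'} = λ_G ≫ 𝓗om((E ⊗ M)^∨, g)`.

Which Ext groups: none; which twist: `- ⊗ M_B`, `M_B = lineBundle c`.

## References

* R. Hartshorne, *Algebraic Geometry* (1977), II.5, II Ex. 5.1 (b). [Hartshorne1977]
* M. F. Atiyah, *Complex analytic connections in fibre bundles*, Trans. AMS 85 (1957), §4. [Atiyah1957]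
-/

noncomputable section

open CategoryTheory AlgebraicGeometry Opposite TopologicalSpace

namespace Summit.Ventures.HSemireg

namespace CocycleTwist

open Literature.AlgebraicGeometry.Modules Literature.AlgebraicGeometry.Motives

universe u

variable {X : Scheme.{u}} (c : UnitCocycle X) (E : X.Modules) {G G' : X.Modules}

/-- **Values of `λ_G(φ ⊗ t_x)`** on a section `μ` of `(E⟨c⟩)^∨` over `W ⊆ V ∩ U_y`: `g_{yx} · φ(t_y ≫ μ)`.
[folklore] -/
theorem appLE_dualHomTwist_trivSection (x y : X) {V W : X.Opens} (hV : V ≤ c.U x) (l : W ⟶ V) (hy : W ≤ c.U y)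
    (φ : (dual E).over V ⟶ G.over V) (μ : (twist c E).over W ⟶ (unitModule X).over W) :
    appLE ((dualHomTwist c E G).app V (trivSection c (sheafHom (dual E) G) x hV φ) :
        (dual (twist c E)).over V ⟶ G.over V) l (μ : Γ(dual (twist c E), W)) =
      c.g y x W hy (l.le.trans hV) • appLE φ l ((toTwistOver c E y W hy ≫ μ : Γ(dual E, W))) := by
  rw [appLE_dualHomTwist c E G y _ l hy, comp_trivSection]
  change appLE ((restrictHom (homOfLE (inf_le_left : V ⊓ c.U y ≤ V)) φ) ≫
      overScalar G (V ⊓ c.U y) (c.g y x (V ⊓ c.U y) inf_le_right (inf_le_left.trans hV))) _ _ = _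
  rw [appLE_smul', appLE_restrictHom, map_g_apply]
  exact congrArg _ (appLE_congr_hom _ _ _ _)

/-- **`λ_{G'}((φ ≫ t) ⊗ t_x) = λ_G(φ ⊗ t_x) ≫ t`** for a local morphism of coefficients `t : G|_U → G'|_U`, a local
homomorphism `φ : E^∨|_V → G|_V` and `V ⊆ U ∩ U_x` (both sides evaluate a section `μ` of `(E⟨c⟩)^∨` over `W ⊆ V ∩ U_y`
to `g_{yx} · t(φ(t_y ≫ μ))`). [folklore] -/
theorem dualHomTwist_app_trivSection_comp (x : X) {U V : X.Opens} (k : V ⟶ U) (hV : V ≤ c.U x)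
    (t : G.over U ⟶ G'.over U) (φ : (dual E).over V ⟶ G.over V) :
    ((dualHomTwist c E G').app V (trivSection c (sheafHom (dual E) G') x hV
        ((φ ≫ restrictHom k t : (dual E).over V ⟶ G'.over V))) : (dual (twist c E)).over V ⟶ G'.over V) =
      ((dualHomTwist c E G).app V (trivSection c (sheafHom (dual E) G) x hV φ) :
        (dual (twist c E)).over V ⟶ G.over V) ≫ restrictHom k t := by
  refine hom_ext_of_appLE_le c fun y W l hy (μ : (twist c E).over W ⟶ (unitModule X).over W) => ?_
  rw [appLE_dualHomTwist_trivSection c E x y hV l hy, appLE_comp, appLE_comp, appLE_restrictHom, appLE_restrictHom,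
    appLE_dualHomTwist_trivSection c E x y hV l hy, appLE_smul_right]

/-- **Naturality of `λ` in the coefficients** (global morphisms `g : G → G'`):
`(𝓗om(E^∨, g))⟨c⟩ ≫ λ_{G'} = λ_G ≫ 𝓗om((E⟨c⟩)^∨, g)`. [folklore] -/
theorem twistMap_sheafHomMap_comp_dualHomTwist (g : G ⟶ G') :
    twistMap c (sheafHomMap (dual E) g) ≫ dualHomTwist c E G' = dualHomTwist c E G ≫ sheafHomMap (dual (twist c E)) g := by
  refine Scheme.Modules.hom_ext _ _ fun V => ?_
  ext s
  rw [Scheme.Modules.Hom.comp_app, Scheme.Modules.Hom.comp_app, CategoryTheory.comp_apply, CategoryTheory.comp_apply,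
    sheafHomMap_app_apply, dualHomTwist_app_apply, dualHomTwist_app_apply]
  refine hom_ext_of_appLE_le c fun y W l hy (μ : (twist c E).over W ⟶ (unitModule X).over W) => ?_
  rw [appLE_comp, appLE_over_map, appLE_dualHomTwistApp c E G' _ y l hy, appLE_dualHomTwistApp c E G _ y l hy,
    comp_twistMap_app, sheafHomMap_app_apply, appLE_comp, appLE_over_map]

end CocycleTwist

end Summit.Ventures.HSemireg

end
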